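import Literature.NumberTheory.Sieve.SieveAdjointP
import Literature.NumberTheory.Sieve.DelayEquationDecay
import Literature.NumberTheory.Sieve.BetaSieveForward
import Literature.NumberTheory.Sieve.SieveFunctionsBridge
import HarnessLib

/-!
# Existence of the linear sieve functions: `β_1 = 2`, `A_1 = 2/p_1(1)`

Trunk `AntSieve` (topic `NumberTheory/Sieve`). For the LINEAR sieve (`κ = 1`) all ingredients of
Iwaniec's construction of the `β`-sieve functions are elementary: the adjoint of the `Q = F − f`
equation is the polynomial `q_1(s) = s − 1` [Greaves2001, (4.2.3.3)], whose only zero is `1`, so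
`β_1 = 2` [Greaves2001, (4.2.4.9)–(4.2.4.10)]; the adjoint of the `P = F + f` equation is the
Laplace transform `p_1` (`rosserAdjointP 1`, file `SieveAdjointP`), and
`A_1 = 2/p_1(1)` [Greaves2001, Lemma 4.2.5 (4.11)] (`= 2e^γ`, ibid., via `p_1(1) = e^{−γ}`, an
identity not proved here). This file PROVES that the forward solution (`BetaSieveForward`) with
`κ = 1`, `β = 2`, `A = 2/p_1(1)` is NORMALISED, `F, f = 1 + O(e^{−s})`, by Iwaniec's argument
[Greaves2001, §4.2.4, proof of Lemma 4.2.6]: the inner products `⟨F − f, q_1⟩` and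
`⟨F + f − 2, p_1⟩` vanish (Lemma 4.2.1 = `sieveInnerProduct_eq`, with `q_1(β − 1) = 0`, resp.
`A p_1(β − 1) = 2` and `⟨1, p_1⟩ ≡ 1`), which yields the delay inequalities
`s |U(s)| ≤ M ∫_{s−1}^{s} |U|` and hence super-exponential decay (Lemma 4.2.7 =
`isBigO_exp_neg_of_delay_ineq`). Consequences: the linear sieve data EXIST
(`LinearSieve.isBetaSieveSolution`, `LinearSieve.exists_isBetaSieveData`), the canonical data
`betaSieveData 1` of `SieveFunctions` solve the system UNCONDITIONALLY
(`isBetaSieveSolution_upperSieveFun_one`), the named fact `siftingLimit_one` (`β_1 = 2`) is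
DISCHARGED (`siftingLimit_one_holds`), and `betaSieveConst 1 = 2/p_1(1)` (`betaSieveConst_one_eq`);
likewise for Iwaniec's greatest-`β` pin: `LinearSieve.exists_isGreatestBetaSieveData` (the case
`κ = 1` of the named fact `exists_isGreatestBetaSieveData`, PROVED), `iwaniecSiftingLimit_one`
(`β_1 = 2`) and `iwaniecSieveConst_one_eq`, all unconditional.

## References

* [Greaves2001] G. Greaves, *Sieves in Number Theory*, Springer (2001), §4.2.3 (3.3), (3.6), (3.8);
  §4.2.4 (4.2), (4.4), (4.9)–(4.11), Lemma 4.2.5, Lemma 4.2.6 and its proof, Lemma 4.2.7.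
* [JurkatRichertActaArith1965] W. B. Jurkat, H.-E. Richert, Acta Arith. 11 (1965) (`β_1 = 2`).
-/

open Filter Asymptotics Set Topology MeasureTheory

noncomputable section

namespace Literature.NumberTheory.Sieve

namespace LinearSieve

/-- `A_1 = 2 / p_1(1)`, the constant of the linear sieve [Greaves2001, Lemma 4.2.5 (4.11) with
`κ = 1`, `β = 2`] (`= 2e^γ`, ibid.). [cite: Greaves2001, Lemma 4.2.5 (4.11)] -/
def const : ℝ :=
  2 / rosserAdjointP 1 1

/-- `F_1`, the upper function of the linear sieve: the forward solution with `κ = 1`, `β = 2`,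
`A = A_1`. [cite: Greaves2001, §4.2.1 (1.1)–(1.3) and (4.2.4.9)] -/
def upperFun : ℝ → ℝ :=
  BetaSieveForward.upper 1 2 const

/-- `f_1`, the lower function of the linear sieve: the forward solution with `κ = 1`, `β = 2`,
`A = A_1`. [cite: Greaves2001, §4.2.1 (1.1)–(1.3) and (4.2.4.9)] -/
def lowerFun : ℝ → ℝ :=
  BetaSieveForward.lower 1 2 const

/-- `p_1(1) > 0`. [folklore] -/
theorem rosserAdjointP_one_pos : 0 < rosserAdjointP 1 1 :=
  rosserAdjointP.pos zero_le_one one_pos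

/-- `A_1 > 0`. [folklore] -/
theorem const_pos : 0 < const :=
  div_pos two_pos rosserAdjointP_one_pos

/-- `A_1 p_1(1) = 2`. [folklore] -/
theorem const_mul_rosserAdjointP_one : const * rosserAdjointP 1 1 = 2 :=
  div_mul_cancel₀ _ rosserAdjointP_one_pos.ne'

/-! ### The forward solution for `κ = 1`, `β = 2` -/

/-- `F_1(s) = A_1 s^{−1}` for `s ≤ 3`. [folklore] -/
theorem upperFun_eq {s : ℝ} (hs : s ≤ 3) : upperFun s = const * s ^ (-(1 : ℝ)) :=
  BetaSieveForward.upper_eq (by norm_num; exact hs)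

/-- `f_1(s) = 0` for `s ≤ 2`. [folklore] -/
theorem lowerFun_eq {s : ℝ} (hs : s ≤ 2) : lowerFun s = 0 :=
  BetaSieveForward.lower_eq hs

/-- `F_1` is continuous on `(0, ∞)`. [folklore] -/
theorem continuousOn_upperFun : ContinuousOn upperFun (Ioi 0) :=
  BetaSieveForward.continuousOn_upper (by norm_num)

/-- `f_1` is continuous on `(0, ∞)`. [folklore] -/
theorem continuousOn_lowerFun : ContinuousOn lowerFun (Ioi 0) :=
  BetaSieveForward.continuousOn_lower (by norm_num)

/-- `(s F_1(s))' = f_1(s − 1)` for `s > 3`. [cite: Greaves2001, §4.2.1 (1.1)] -/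
theorem hasDerivAt_upperFun {s : ℝ} (hs : 3 < s) :
    HasDerivAt (fun t : ℝ => t ^ (1 : ℝ) * upperFun t) (lowerFun (s - 1)) s := by
  have h := BetaSieveForward.hasDerivAt_upper (κ := 1) (β := 2) (A := const) (by norm_num)
    (by norm_num; exact hs)
  refine h.congr_deriv ?_
  norm_num
  rfl

/-- `(s f_1(s))' = F_1(s − 1)` for `s > 2`. [cite: Greaves2001, §4.2.1 (1.2)] -/
theorem hasDerivAt_lowerFun {s : ℝ} (hs : 2 < s) :
    HasDerivAt (fun t : ℝ => t ^ (1 : ℝ) * lowerFun t) (upperFun (s - 1)) s := by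
  have h := BetaSieveForward.hasDerivAt_lower (κ := 1) (β := 2) (A := const) (by norm_num) hs
  refine h.congr_deriv ?_
  norm_num
  rfl

/-- On `(0, 3)` the function `t ↦ t F(t) = A_1` is locally constant. [folklore] -/
theorem hasDerivAt_upperFun_zero {t : ℝ} (ht0 : 0 < t) (ht : t < 3) :
    HasDerivAt (fun u : ℝ => u ^ (1 : ℝ) * upperFun u) 0 t := by
  refine (hasDerivAt_const t const).congr_of_eventuallyEq ?_
  filter_upwards [Ioo_mem_nhds ht0 ht] with u hu
  rw [upperFun_eq hu.2.le, Real.rpow_one, Real.rpow_neg_one, mul_left_comm,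
    mul_inv_cancel₀ hu.1.ne', mul_one]

/-! ### `Q = F − f`: vanishing inner product with `q_1 = s − 1`, decay -/

/-- `Q = F − f` is `A_1 x^{−1}` on `(0, 2]`. [folklore] -/
theorem sub_eq {x : ℝ} (hx : x ∈ Ioc (0 : ℝ) 2) :
    upperFun x - lowerFun x = const * x ^ (-(1 : ℝ)) := by
  rw [upperFun_eq (by linarith [hx.2]), lowerFun_eq hx.2, sub_zero]

/-- `P = F + f` is `A_1 x^{−1}` on `(0, 2]`. [folklore] -/
theorem add_eq {x : ℝ} (hx : x ∈ Ioc (0 : ℝ) 2) :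
    upperFun x + lowerFun x = const * x ^ (-(1 : ℝ)) := by
  rw [upperFun_eq (by linarith [hx.2]), lowerFun_eq hx.2, add_zero]

/-- The delay equation of `Q = F − f` (`κ = 1`): `(t Q(t))' = −Q(t − 1)` for `t > 2`, `t ≠ 3`.
[cite: Greaves2001, §4.2.1 (1.9), (1.13)] -/
theorem hasDerivAt_sub {t : ℝ} (ht : 2 < t) (ht3 : t ≠ 2 + 1) :
    HasDerivAt (fun u : ℝ => u ^ (1 : ℝ) * (upperFun u - lowerFun u))
      (-1 * t ^ ((1 : ℝ) - 1) * (upperFun (t - 1) - lowerFun (t - 1))) t := by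
  have hfun : (fun u : ℝ => u ^ (1 : ℝ) * (upperFun u - lowerFun u)) =
      fun u => u ^ (1 : ℝ) * upperFun u - u ^ (1 : ℝ) * lowerFun u := by
    funext u; ring
  rw [hfun]
  rcases lt_or_gt_of_ne ht3 with hlt | hgt
  · have hf0 : lowerFun (t - 1) = 0 := lowerFun_eq (by linarith)
    refine ((hasDerivAt_upperFun_zero (by linarith) (by linarith)).sub
      (hasDerivAt_lowerFun ht)).congr_deriv ?_
    rw [hf0]; norm_num
  · refine ((hasDerivAt_upperFun (by linarith)).sub (hasDerivAt_lowerFun ht)).congr_deriv ?_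
    norm_num

/-- The delay equation of `P = F + f` (`κ = 1`): `(t P(t))' = P(t − 1)` for `t > 2`, `t ≠ 3`.
[cite: Greaves2001, §4.2.1 (1.9), (1.13)] -/
theorem hasDerivAt_add {t : ℝ} (ht : 2 < t) (ht3 : t ≠ 2 + 1) :
    HasDerivAt (fun u : ℝ => u ^ (1 : ℝ) * (upperFun u + lowerFun u))
      (-(-1) * t ^ ((1 : ℝ) - 1) * (upperFun (t - 1) + lowerFun (t - 1))) t := by
  have hfun : (fun u : ℝ => u ^ (1 : ℝ) * (upperFun u + lowerFun u)) =
      fun u => u ^ (1 : ℝ) * upperFun u + u ^ (1 : ℝ) * lowerFun u := by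
    funext u; ring
  rw [hfun]
  rcases lt_or_gt_of_ne ht3 with hlt | hgt
  · have hf0 : lowerFun (t - 1) = 0 := lowerFun_eq (by linarith)
    refine ((hasDerivAt_upperFun_zero (by linarith) (by linarith)).add
      (hasDerivAt_lowerFun ht)).congr_deriv ?_
    rw [hf0]; norm_num
  · refine ((hasDerivAt_upperFun (by linarith)).add (hasDerivAt_lowerFun ht)).congr_deriv ?_
    norm_num
    ring

/-- **`⟨F − f, q_1⟩ = 0`** (`q_1(s) = s − 1`, `q_1(β − 1) = q_1(1) = 0`) [Greaves2001, (4.2) with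
(4.7), `B = 0`, and (4.9)]: `s (s − 1) Q(s) = ∫_{s−1}^{s} x Q(x) dx` for `s ≥ 2`.
[cite: Greaves2001, §4.2.4 (4.2), (4.7), (4.9)] -/
theorem sieveInnerProduct_sub (s : ℝ) (hs : 2 ≤ s) :
    sieveInnerProduct 1 (fun x => upperFun x - lowerFun x) (fun x => x - 1) s = 0 := by
  have h := sieveInnerProduct_eq (a := 1) (b := 1) (β := 2) (A := const) (by norm_num)
    isSieveAdjoint_one (continuousOn_upperFun.sub continuousOn_lowerFun) (fun x hx => sub_eq hx)
    (fun t ht ht3 => hasDerivAt_sub ht ht3) hs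
  have h' : sieveInnerProduct 1 (fun x => upperFun x - lowerFun x) (fun x => x - 1) s =
      const * (2 - 1) ^ (1 - 1 : ℝ) * (2 - 1 - 1) := h
  rw [h']; norm_num

/-- The delay inequality for `Q`: `s |Q(s)| ≤ 2 ∫_{s−1}^{s} |Q|` for `s ≥ 2`. [folklore] -/
theorem delay_ineq_sub (s : ℝ) (hs : 2 ≤ s) :
    s * |upperFun s - lowerFun s| ≤ 2 * ∫ x in (s - 1)..s, |upperFun x - lowerFun x| := by
  set Q : ℝ → ℝ := fun x => upperFun x - lowerFun x with hQ
  have h0 := sieveInnerProduct_sub s hs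
  rw [sieveInnerProduct_def] at h0
  have hs0 : 0 < s := by linarith
  have hQc : ContinuousOn Q (Icc (s - 1) s) :=
    (continuousOn_upperFun.sub continuousOn_lowerFun).mono fun x hx => show 0 < x by
      linarith [hx.1]
  have hint1 : IntervalIntegrable (fun x => |x * Q x|) volume (s - 1) s := by
    refine ((continuousOn_id.mul hQc).abs.mono ?_).intervalIntegrable
    rw [uIcc_of_le (by linarith)]
  have hint2 : IntervalIntegrable (fun x => s * |Q x|) volume (s - 1) s := by
    refine ((continuousOn_const.mul hQc.abs).mono ?_).intervalIntegrable
    rw [uIcc_of_le (by linarith)]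
  -- `s (s-1) Q s = ∫ x Q x`
  have h1 : s * (s - 1) * Q s = ∫ x in (s - 1)..s, x * Q x := by
    have : ∫ x in (s - 1)..s, (x + 1 - 1) * Q x = ∫ x in (s - 1)..s, x * Q x := by
      refine intervalIntegral.integral_congr fun x _ => ?_; simp only [add_sub_cancel_right]
    simp only [one_mul] at h0
    linarith [h0, this]
  have h2 : |∫ x in (s - 1)..s, x * Q x| ≤ ∫ x in (s - 1)..s, s * |Q x| := by
    refine (intervalIntegral.abs_integral_le_integral_abs (by linarith)).trans ?_
    refine intervalIntegral.integral_mono_on (by linarith) hint1 hint2 fun x hx => ?_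
    rw [abs_mul, abs_of_nonneg (by linarith [hx.1] : (0 : ℝ) ≤ x)]
    exact mul_le_mul_of_nonneg_right hx.2 (abs_nonneg _)
  rw [intervalIntegral.integral_const_mul] at h2
  have h3 : s * (s - 1) * |Q s| ≤ s * ∫ x in (s - 1)..s, |Q x| := by
    have := h2
    rw [← h1, abs_mul, abs_mul, abs_of_pos hs0, abs_of_nonneg (by linarith : (0 : ℝ) ≤ s - 1)]
      at this
    exact this
  have h4 : (s - 1) * |Q s| ≤ ∫ x in (s - 1)..s, |Q x| := by
    have := mul_le_mul_of_nonneg_left h3 (inv_nonneg.mpr hs0.le)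
    field_simp at this
    linarith [this]
  have h5 : 0 ≤ |Q s| := abs_nonneg _
  nlinarith

/-- **`F − f = O(e^{−s})`** for the linear sieve [Greaves2001, Lemma 4.2.6].
[cite: Greaves2001, Lemma 4.2.6] -/
theorem isBigO_sub : (fun s => upperFun s - lowerFun s) =O[atTop] fun s => Real.exp (-s) :=
  isBigO_exp_neg_of_delay_ineq (s₀ := 2) (M := 2)
    ((continuousOn_upperFun.sub continuousOn_lowerFun).mono fun x (hx : 2 - 1 < x) =>
      show 0 < x by linarith)
    fun s hs => delay_ineq_sub s hs.le

/-! ### `P = F + f`: inner products with `p_1`, decay of `P − 2` -/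

/-- **`⟨F + f, p_1⟩ = 2`** [Greaves2001, (4.4) with (4.7), `B = 0`, and (4.11)]:
`s p_1(s) P(s) + ∫_{s−1}^{s} p_1(x + 1) P(x) dx = A_1 p_1(1) = 2` for `s ≥ 2`.
[cite: Greaves2001, §4.2.4 (4.4), (4.7), (4.11)] -/
theorem sieveInnerProduct_add (s : ℝ) (hs : 2 ≤ s) :
    sieveInnerProduct (-1) (fun x => upperFun x + lowerFun x) (rosserAdjointP 1) s = 2 := by
  have h := sieveInnerProduct_eq (a := 1) (b := -1) (β := 2) (A := const) (by norm_num)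
    (isSieveAdjoint_rosserAdjointP zero_le_one) (continuousOn_upperFun.add continuousOn_lowerFun)
    (fun x hx => add_eq hx) (fun t ht ht3 => hasDerivAt_add ht ht3) hs
  have h' : sieveInnerProduct (-1) (fun x => upperFun x + lowerFun x) (rosserAdjointP 1) s =
      const * (2 - 1) ^ (1 - 1 : ℝ) * rosserAdjointP 1 (2 - 1) := h
  rw [h']
  norm_num
  exact const_mul_rosserAdjointP_one

/-- `p_1` is continuous on `(0, ∞)`. [folklore] -/
theorem continuousOn_rosserAdjointP_one : ContinuousOn (rosserAdjointP 1) (Ioi 0) :=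
  (isSieveAdjoint_rosserAdjointP zero_le_one).continuousOn

/-- **`⟨1, p_1⟩ ≡ 1`**: `s p_1(s) + ∫_{s−1}^{s} p_1(x + 1) dx = 1` for `s > 1` (the constant `2`
solves the `P`-equation; its inner product with `p_1` is constant — derivative
`(s p)' + p(s + 1) − p(s) = 0` — and tends to `1` since `s p_1(s) → 1`, `p_1 → 0`)
[Greaves2001, proof of Lemma 4.2.6: "the second of these holds also when `P(s) = 2`"].
[cite: Greaves2001, §4.2.4, proof of Lemma 4.2.6] -/
theorem inner_one (s : ℝ) (hs : 1 < s) :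
    s * rosserAdjointP 1 s + ∫ x in (s - 1)..s, rosserAdjointP 1 (x + 1) = 1 := by
  set p : ℝ → ℝ := rosserAdjointP 1 with hp
  -- the shifted function `g x = p (x + 1)` is continuous on `(-1, ∞)`
  set g : ℝ → ℝ := fun x => p (x + 1) with hg
  have hgc : ContinuousOn g (Ioi (-1)) := by
    refine continuousOn_rosserAdjointP_one.comp (continuousOn_id.add continuousOn_const)
      fun x (hx : -1 < x) => ?_
    show 0 < x + 1
    linarith
  have hgi : ∀ {u v : ℝ}, -1 < u → -1 < v → IntervalIntegrable g volume u v := by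
    intro u v hu hv
    refine (hgc.mono fun x hx => ?_).intervalIntegrable
    exact lt_of_lt_of_le (lt_min hu hv) hx.1
  set Φ : ℝ → ℝ := fun u => ∫ x in (0 : ℝ)..u, g x with hΦ
  have hΦd : ∀ u : ℝ, -1 < u → HasDerivAt Φ (g u) u := fun u hu =>
    intervalIntegral.integral_hasDerivAt_right (hgi (by norm_num) hu)
      (hgc.stronglyMeasurableAtFilter isOpen_Ioi u hu) (hgc.continuousAt (Ioi_mem_nhds hu))
  -- `Ψ u = u p u + Φ u - Φ (u - 1)`
  set Ψ : ℝ → ℝ := fun u => u * p u + (Φ u - Φ (u - 1)) with hΨ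
  have hΨeq : ∀ u : ℝ, 0 < u → u * p u + ∫ x in (u - 1)..u, g x = Ψ u := by
    intro u hu
    simp only [hΨ, hΦ]
    rw [intervalIntegral.integral_interval_sub_left (hgi (by norm_num) (by linarith))
      (hgi (by norm_num) (by linarith))]
  have hΨd : ∀ u : ℝ, 1 < u → HasDerivAt Ψ 0 u := by
    intro u hu
    have h1 := rosserAdjointP.hasDerivAt_mul (κ := 1) zero_le_one (by linarith : 0 < u)
    have h2 : HasDerivAt (fun v => Φ v - Φ (v - 1)) (g u - g (u - 1)) u :=
      (hΦd u (by linarith)).sub (HasDerivAt.comp_sub_const u 1 (hΦd (u - 1) (by linarith)))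
    refine (h1.add h2).congr_deriv ?_
    simp only [hg, hp, sub_add_cancel]
    ring
  -- constancy on `(1, ∞)`
  have hconst : ∀ {u v : ℝ}, 1 < u → 1 < v → Ψ u = Ψ v := by
    intro u v hu hv
    exact isOpen_Ioi.is_const_of_deriv_eq_zero isPreconnected_Ioi
      (fun y (hy : 1 < y) => (hΨd y hy).differentiableAt.differentiableWithinAt)
      (fun y (hy : 1 < y) => (hΨd y hy).deriv) hu hv
  -- the limit at infinity is `1`
  have hp0 : Tendsto p atTop (𝓝 0) := by
    have h1 := (rosserAdjointP.tendsto_mul (κ := 1) zero_le_one).mul tendsto_inv_atTop_zero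
    rw [one_mul] at h1
    refine h1.congr' ?_
    filter_upwards [eventually_gt_atTop (0 : ℝ)] with u hu
    show u * p u * u⁻¹ = p u
    field_simp
  have hint0 : Tendsto (fun u : ℝ => ∫ x in (u - 1)..u, g x) atTop (𝓝 0) := by
    refine squeeze_zero' ?_ ?_ hp0
    · filter_upwards [eventually_gt_atTop (1 : ℝ)] with u hu
      exact intervalIntegral.integral_nonneg (by linarith) fun x hx =>
        (rosserAdjointP.pos zero_le_one (by linarith [hx.1])).le
    · filter_upwards [eventually_gt_atTop (1 : ℝ)] with u hu
      have : ∫ x in (u - 1)..u, g x ≤ ∫ _ in (u - 1)..u, p u := by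
        refine intervalIntegral.integral_mono_on (by linarith) (hgi (by linarith) (by linarith))
          (by simp) fun x hx => ?_
        exact rosserAdjointP.apply_add_one_le zero_le_one (by linarith) hx.1
      simpa using this
  have hlim : Tendsto Ψ atTop (𝓝 1) := by
    have h1 := (rosserAdjointP.tendsto_mul (κ := 1) zero_le_one).add hint0
    rw [add_zero] at h1
    refine h1.congr' ?_
    filter_upwards [eventually_gt_atTop (0 : ℝ)] with u hu
    exact hΨeq u hu
  -- conclusion
  have hΨs : Ψ s = 1 := by
    have h1 : Tendsto Ψ atTop (𝓝 (Ψ s)) :=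
      (tendsto_const_nhds (x := Ψ s)).congr'
        (by filter_upwards [eventually_gt_atTop (1 : ℝ)] with u hu; exact hconst hs hu)
    exact tendsto_nhds_unique h1 hlim
  have hfin := hΨeq s (by linarith)
  rw [hΨs] at hfin
  simpa only [hg, hp] using hfin

/-- The delay inequality for `U = F + f − 2`: `s |U(s)| ≤ ∫_{s−1}^{s} |U|` for `s ≥ 2`
(from `⟨F + f, p_1⟩ = 2 = ⟨2, p_1⟩`, `p_1` positive and antitone). [folklore] -/
theorem delay_ineq_add (s : ℝ) (hs : 2 ≤ s) :
    s * |upperFun s + lowerFun s - 2| ≤ ∫ x in (s - 1)..s, |upperFun x + lowerFun x - 2| := by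
  set U : ℝ → ℝ := fun x => upperFun x + lowerFun x - 2 with hU
  set p : ℝ → ℝ := rosserAdjointP 1 with hp
  have hs0 : 0 < s := by linarith
  have hps : 0 < p s := rosserAdjointP.pos zero_le_one hs0
  have h0 := sieveInnerProduct_add s hs
  rw [sieveInnerProduct_def] at h0
  have h1 := inner_one s (by linarith)
  -- continuity / integrability on `[s - 1, s]`
  have hPc : ContinuousOn (fun x => upperFun x + lowerFun x) (Icc (s - 1) s) :=
    (continuousOn_upperFun.add continuousOn_lowerFun).mono fun x hx => show 0 < x by
      linarith [hx.1]
  have hgc : ContinuousOn (fun x => p (x + 1)) (Icc (s - 1) s) := by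
    refine continuousOn_rosserAdjointP_one.comp (continuousOn_id.add continuousOn_const)
      fun x hx => ?_
    show 0 < x + 1
    linarith [hx.1]
  have hI : ∀ {φ : ℝ → ℝ}, ContinuousOn φ (Icc (s - 1) s) → IntervalIntegrable φ volume (s - 1) s :=
    fun hφ => (hφ.mono (by rw [uIcc_of_le (by linarith)])).intervalIntegrable
  have hiP : IntervalIntegrable (fun x => p (x + 1) * (upperFun x + lowerFun x)) volume (s - 1) s :=
    hI (hgc.mul hPc)
  have hig : IntervalIntegrable (fun x => p (x + 1)) volume (s - 1) s := hI hgc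
  -- the vanishing inner product of `U`
  have h2 : s * p s * U s + ∫ x in (s - 1)..s, p (x + 1) * U x = 0 := by
    have hsplit : ∫ x in (s - 1)..s, p (x + 1) * U x =
        (∫ x in (s - 1)..s, p (x + 1) * (upperFun x + lowerFun x)) -
          2 * ∫ x in (s - 1)..s, p (x + 1) := by
      rw [← intervalIntegral.integral_const_mul, ← intervalIntegral.integral_sub hiP
        (hig.const_mul 2)]
      refine intervalIntegral.integral_congr fun x _ => ?_
      simp only [hU]; ring
    rw [hsplit]
    simp only [hU, neg_mul, one_mul, sub_neg_eq_add] at h0 ⊢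
    linear_combination h0 - 2 * h1
  -- estimate
  have hiU : IntervalIntegrable (fun x => |p (x + 1) * U x|) volume (s - 1) s :=
    hI ((hgc.mul (hPc.sub continuousOn_const)).abs)
  have hiU' : IntervalIntegrable (fun x => p s * |U x|) volume (s - 1) s :=
    hI (continuousOn_const.mul (hPc.sub continuousOn_const).abs)
  have h3 : |∫ x in (s - 1)..s, p (x + 1) * U x| ≤ p s * ∫ x in (s - 1)..s, |U x| := by
    rw [← intervalIntegral.integral_const_mul]
    refine (intervalIntegral.abs_integral_le_integral_abs (by linarith)).trans ?_
    refine intervalIntegral.integral_mono_on (by linarith) hiU hiU' fun x hx => ?_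
    rw [abs_mul, abs_of_pos (rosserAdjointP.pos zero_le_one (by linarith [hx.1]))]
    exact mul_le_mul_of_nonneg_right
      (rosserAdjointP.apply_add_one_le zero_le_one hs0 hx.1) (abs_nonneg _)
  have h4 : s * p s * |U s| ≤ p s * ∫ x in (s - 1)..s, |U x| := by
    have : s * p s * U s = -∫ x in (s - 1)..s, p (x + 1) * U x := by linarith
    have habs : s * p s * |U s| = |s * p s * U s| := by
      rw [abs_mul, abs_of_pos (mul_pos hs0 hps)]
    rw [habs, this, abs_neg]
    exact h3
  have h5 := mul_le_mul_of_nonneg_left h4 (inv_nonneg.mpr hps.le)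
  field_simp at h5
  linarith [h5]

/-- **`F + f − 2 = O(e^{−s})`** for the linear sieve [Greaves2001, Lemma 4.2.6].
[cite: Greaves2001, Lemma 4.2.6] -/
theorem isBigO_add : (fun s => upperFun s + lowerFun s - 2) =O[atTop] fun s => Real.exp (-s) :=
  isBigO_exp_neg_of_delay_ineq (s₀ := 2) (M := 1)
    (((continuousOn_upperFun.add continuousOn_lowerFun).sub continuousOn_const).mono
      fun x (hx : 2 - 1 < x) => show 0 < x by linarith)
    fun s hs => by rw [one_mul]; exact delay_ineq_add s hs.le

/-! ### The normalised solution and its consequences -/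

/-- **`F_1 = 1 + O(e^{−s})`**. [cite: Greaves2001, Lemma 4.2.6] -/
theorem upper_isBigO : (fun s => upperFun s - 1) =O[atTop] fun s => Real.exp (-s) := by
  refine ((isBigO_add.add isBigO_sub).const_mul_left (1 / 2)).congr_left fun s => ?_
  ring

/-- **`f_1 = 1 + O(e^{−s})`**. [cite: Greaves2001, Lemma 4.2.6] -/
theorem lower_isBigO : (fun s => lowerFun s - 1) =O[atTop] fun s => Real.exp (-s) := by
  refine ((isBigO_add.sub isBigO_sub).const_mul_left (1 / 2)).congr_left fun s => ?_
  ring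

/-- **Existence of the linear sieve functions**: `(F_1, f_1, 2, A_1)` with `A_1 = 2/p_1(1)` is a
normalised solution of the Rosser–Iwaniec system of dimension `1` [Greaves2001, Prop. 4.2.1,
Lemma 4.2.5, Lemma 4.2.6 for `κ = 1`; Jurkat–Richert 1965].
[cite: Greaves2001, Lemma 4.2.5–4.2.6] -/
theorem isBetaSieveSolution : IsBetaSieveSolution 1 upperFun lowerFun 2 const :=
  BetaSieveForward.isBetaSieveSolution (by norm_num) const_pos upper_isBigO lower_isBigO

/-- The least-`β` data of dimension `1` exist (the extremality clause is vacuous for `κ = 1`,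
`isBetaSieveData_one_iff`): the case `κ = 1` of the named fact `exists_isBetaSieveData`.
[cite: Greaves2001, Lemma 4.2.5–4.2.6] -/
theorem exists_isBetaSieveData : ∃ B : (ℝ → ℝ) × (ℝ → ℝ) × ℝ × ℝ, IsBetaSieveData 1 B :=
  ⟨(upperFun, lowerFun, 2, const), (isBetaSieveData_one_iff _).mpr isBetaSieveSolution⟩

end LinearSieve

/-- The canonical data `betaSieveData 1` of `SieveFunctions` ARE `β`-sieve data, unconditionally
(`Classical.epsilon_spec` with the witness `LinearSieve.exists_isBetaSieveData`). [folklore] -/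
theorem isBetaSieveData_betaSieveData_one : IsBetaSieveData 1 (betaSieveData 1) :=
  Classical.epsilon_spec LinearSieve.exists_isBetaSieveData

/-- `(upperSieveFun 1, lowerSieveFun 1, siftingLimit 1, betaSieveConst 1)` solve the normalised
linear-sieve system, unconditionally. [folklore] -/
theorem isBetaSieveSolution_upperSieveFun_one :
    IsBetaSieveSolution 1 (upperSieveFun 1) (lowerSieveFun 1) (siftingLimit 1) (betaSieveConst 1) :=
  isBetaSieveData_betaSieveData_one.1

/-- **Discharge of the named fact `siftingLimit_one` (`β_1 = 2`)** of `SieveFunctions`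
(Jurkat–Richert 1965; [Greaves2001, (4.2.4.9)–(4.2.4.10)]): the canonical data exist
(`isBetaSieveData_betaSieveData_one`) and every normalised solution of dimension `1` has `β = 2`
(`IsBetaSieveSolution.beta_eq_two`). [cite: Greaves2001, §4.2.4 (4.9)–(4.10)] -/
theorem siftingLimit_one_holds : siftingLimit_one :=
  isBetaSieveSolution_upperSieveFun_one.beta_eq_two

/-- **`A_1 = 2/p_1(1)`** for the canonical constant: `betaSieveConst 1 = 2 / rosserAdjointP 1 1`
[Greaves2001, Lemma 4.2.5 (4.11)] (`= 2e^γ` by `p_1(1) = e^{−γ}`, ibid., not proved here; the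
named fact `upperSieveFun_one_eq` is thereby reduced to this classical identity).
[cite: Greaves2001, Lemma 4.2.5 (4.11)] -/
theorem betaSieveConst_one_eq : betaSieveConst 1 = 2 / rosserAdjointP 1 1 := by
  have h2 : siftingLimit 1 = 2 := siftingLimit_one_holds
  have h := isBetaSieveSolution_upperSieveFun_one.const_eq_rosserAdjointP zero_le_one
    (by rw [h2]; norm_num)
  rw [h2] at h
  rw [h]
  norm_num

/-- **The linear-sieve upper function on `(0, 3]`**: `upperSieveFun 1 s = (2/p_1(1)) / s`
(compare the named fact `upperSieveFun_one_eq`: `= 2e^γ/s`).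
[cite: Greaves2001, Lemma 4.2.5 (4.11)] -/
theorem upperSieveFun_one_eq_div {s : ℝ} (hs : s ∈ Ioc (0 : ℝ) 3) :
    upperSieveFun 1 s = 2 / rosserAdjointP 1 1 / s := by
  have h := isBetaSieveSolution_upperSieveFun_one.upper_eq s
    (by rw [show siftingLimit 1 = 2 from siftingLimit_one_holds]; norm_num; exact ⟨hs.1, hs.2⟩)
  rw [h, betaSieveConst_one_eq, Real.rpow_neg_one, div_eq_mul_inv _ s]

/-- **The linear-sieve lower function vanishes on `(0, 2]`**: `lowerSieveFun 1 s = 0`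
(unconditionally). [cite: Greaves2001, §4.2.1 (1.3) with (4.2.4.9)] -/
theorem lowerSieveFun_one_eq_zero {s : ℝ} (hs : s ∈ Ioc (0 : ℝ) 2) : lowerSieveFun 1 s = 0 :=
  isBetaSieveSolution_upperSieveFun_one.lower_eq s
    (by rw [show siftingLimit 1 = 2 from siftingLimit_one_holds]; exact hs)

/-! ### Iwaniec's (greatest-`β`) pin for `κ = 1` -/

/-- The linear sieve data `(F_1, f_1, 2, A_1)` are greatest `β`-sieve data of dimension `1` (the
maximality clause is vacuous, `isGreatestBetaSieveData_one_iff`). [folklore] -/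
theorem LinearSieve.isGreatestBetaSieveData :
    IsGreatestBetaSieveData 1 (LinearSieve.upperFun, LinearSieve.lowerFun, 2, LinearSieve.const) :=
  (isGreatestBetaSieveData_one_iff _).mpr LinearSieve.isBetaSieveSolution

/-- **The case `κ = 1` of the named fact `exists_isGreatestBetaSieveData`** of `SieveFunctions`,
PROVED. [cite: Greaves2001, Lemma 4.2.5–4.2.6] -/
theorem LinearSieve.exists_isGreatestBetaSieveData :
    ∃ B : (ℝ → ℝ) × (ℝ → ℝ) × ℝ × ℝ, IsGreatestBetaSieveData 1 B :=
  ⟨_, LinearSieve.isGreatestBetaSieveData⟩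

/-- Iwaniec's canonical data `greatestBetaSieveData 1` ARE greatest `β`-sieve data,
unconditionally. [folklore] -/
theorem isGreatestBetaSieveData_greatestBetaSieveData_one :
    IsGreatestBetaSieveData 1 (greatestBetaSieveData 1) :=
  LinearSieve.isGreatestBetaSieveData.greatestBetaSieveData

/-- **`β_1 = 2` for Iwaniec's pin, unconditionally** [Greaves2001, (4.2.4.9)–(4.2.4.10)]:
`iwaniecSiftingLimit 1 = 2`. [cite: Greaves2001, §4.2.4 (4.9)–(4.10)] -/
theorem iwaniecSiftingLimit_one : iwaniecSiftingLimit 1 = 2 :=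
  isGreatestBetaSieveData_greatestBetaSieveData_one.1.beta_eq_two

/-- **`A_κ = 2(β_κ − 1)^{κ−1}/p_κ(β_κ − 1)`** for Iwaniec's pin [Greaves2001, Lemma 4.2.5 (4.11)],
for `κ ≥ 1`, granted existence (`exists_isGreatestBetaSieveData`; `β_κ > 1` by
`IsBetaSieveSolution.one_lt`). [cite: Greaves2001, Lemma 4.2.5 (4.11)] -/
theorem iwaniecSieveConst_eq (hex : exists_isGreatestBetaSieveData) {κ : ℝ} (hκ : 1 ≤ κ) :
    iwaniecSieveConst κ =
      2 * (iwaniecSiftingLimit κ - 1) ^ (κ - 1) / rosserAdjointP κ (iwaniecSiftingLimit κ - 1) :=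
  have h := isBetaSieveSolution_iwaniecUpperSieveFun_iwaniecLowerSieveFun hex (by linarith)
  h.const_eq_rosserAdjointP (by linarith) (h.one_lt hκ)

/-- **`A_1 = 2/p_1(1)` for Iwaniec's pin**, unconditionally: `iwaniecSieveConst 1 = 2 / p_1(1)`
[Greaves2001, Lemma 4.2.5 (4.11)] (`= 2e^γ`, ibid.). [cite: Greaves2001, Lemma 4.2.5 (4.11)] -/
theorem iwaniecSieveConst_one_eq : iwaniecSieveConst 1 = 2 / rosserAdjointP 1 1 := by
  rw [← betaSieveConst_one, betaSieveConst_one_eq]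

/-- Iwaniec's linear-sieve upper function on `(0, 3]`: `iwaniecUpperSieveFun 1 s = (2/p_1(1))/s`,
unconditionally. [cite: Greaves2001, Lemma 4.2.5 (4.11)] -/
theorem iwaniecUpperSieveFun_one_eq_div {s : ℝ} (hs : s ∈ Ioc (0 : ℝ) 3) :
    iwaniecUpperSieveFun 1 s = 2 / rosserAdjointP 1 1 / s := by
  rw [← upperSieveFun_one, upperSieveFun_one_eq_div hs]

/-- Iwaniec's linear-sieve lower function vanishes on `(0, 2]`, unconditionally.
[cite: Greaves2001, §4.2.1 (1.3)] -/
theorem iwaniecLowerSieveFun_one_eq_zero {s : ℝ} (hs : s ∈ Ioc (0 : ℝ) 2) :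
    iwaniecLowerSieveFun 1 s = 0 := by
  rw [← lowerSieveFun_one, lowerSieveFun_one_eq_zero hs]

end Literature.NumberTheory.Sieve
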